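import Mathlib
import HarnessLib
import Literature.NumberTheory.LFunctions.KMVMomentAsymptoticsBeyondDiagonal
import Literature.NumberTheory.LFunctions.KMVFirstMomentBeyondDiagonal
import Literature.NumberTheory.EllipticCurves.NewformsFiniteProofs
import Summits.Parity.GeneralizedHardyLittlewood.Theses.PrimeLevelFamEdge

/-!
# LINE SKELETON «pairs-beyond-family-size» (lens `decomp` × U-d, cell ls-idea, seat ls-idea-lens-17; card K-L17-1)
# «PAIRS BEYOND FAMILY SIZE»: a PROVED hyperbolic pair split of the crux
# `PrimeLevelFamEdge.MomentsBeyondDiagonal` (K_A, stmt-Parity-20007)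

K_A asks for the KMV mollified-moment asymptotics (both displays of `KMV2000.MomentAsymptotics 1 Δ T₁ T₂`)
on some window of mollifier lengths `M = q̂^{Δ'}`, `Δ' ∈ (1, Δ]`, beyond the diagonal, at an individual
prime level `q`. The registered birth skeleton (`Cruxes/MomentsBeyondDiagonal/Lines/birth.lean`) cuts K_A
MOMENT-WISE (first display / second display). This file cuts the SECOND display along the ARITHMETIC seam
of the printed method instead:

* open the square `|M_P(f)|² = Σ_{m₁,m₂ ≤ M} λ_f(m₁)x_{m₁} · conj(λ_f(m₂)x_{m₂})` and split the PAIRS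
  `(m₁, m₂)` by a weight `ω(q, Δ', m₁, m₂)` (BELOW) and its complement `1 − ω` (ABOVE); the harmonic
  second moment `Q^h(P,Q)` splits accordingly (`QhPQ_eq_pairSplit`, proved: Petersson-side linearity
  `GL2Family.harmonicSum_add` over the finite family `finite_newforms0_holds`, and `|z|² = z·z̄`);
* the instance of record is the SHARP HYPERBOLIC CUT `ω = 𝟙[m₁m₂ ≤ q̂^{ζ(Δ')}]` with `ζ(Δ') = 3 − Δ' < 2`:
  BELOW = mollifier pairs whose product is `≤ q̂^{3−Δ'} = q^{(3−Δ')/2} ≪ q^{1−δ}` (`δ = (Δ'−1)/2 > 0`) —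
  EXACTLY the hypothesis `m₁m₂ ≪ q^{1−δ}` of KMV's Lemma 3.3 [KowalskiMichelVanderKam2000, Lemma 3.3,
  p. 8: "Let N₁N₂ ≪ q(log q)², m₁m₂ ≪ q^{1−δ} … ≪ q^ε (m₁m₂N₁N₂)^{1/2}/q"; p. 13: "using Lemma 3.3,
  one shows (see [I-S] or [VdK2] for details) that the terms coming from the Kloosterman sums have a
  total contribution ≪ q̂^{1−γ} … if Δ < 1"], applied pair by pair, the pair count `#{m₁m₂ ≤ q̂^ζ} ≍
  q̂^ζ log q̂` keeping the total Kloosterman contribution at `q̂ · q̂^{ζ−2+ε}` = `o(main)` iff `ζ < 2`;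
  ABOVE = the pairs whose product EXCEEDS `q̂^{ζ}`, i.e. (up to the margin) exceeds the family size
  `q̂² = q/4π² ≍ |S₂(q)^*|·(12/… )` — precisely the pairs for which Lemma 3.3's hypothesis fails and the
  individual Weil bound (12) loses by `q̂^{2Δ'−1}`: the localized heart (barrier-notes BN-7a's
  single-modulus object, restricted to the hyperbolic corner `m₁m₂ > q̂^{ζ}`).

PROVED here (no `sorry`): the algebraic split `QhPQ_eq_pairSplit` and the glue
`MomentsBeyondDiagonal_of_pairSplit : SubFirst → SubPairs ω → SubPairs (compl ω) → KA` (`KA := MomentsBeyondDiagonal`,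
a local name so that only §5's `MomentsBeyondDiagonal_of` concludes the crux BY NAME — typer's D-0145 conversion
of the seat's file sha16 84f4de63c6196e20, otherwise VERBATIM)
for EVERY cut family `ω` (windows intersected, `T₂ := t_below + t_above − secondMomentForm`, constants
added), and its instance `MomentsBeyondDiagonal_of_hyperbolicSplit` at `ζ(Δ') = 3 − Δ'`.
NOT proved: any of the three pieces. No exceptional-zero theorem (no Landau–Siegel / Siegel-zero
exclusion, no Theorem 1–2 of arXiv:2211.02515, no repaired Margin232) is proved by ideation; typed ≠
proved; computed ≠ proved.
-/

noncomputable section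

open scoped MatrixGroups Real
open CongruenceSubgroup Complex Finset Polynomial
open Literature.NumberTheory.EllipticCurves.ModularForms
open Literature.NumberTheory.LFunctions

namespace Summit.Parity.GeneralizedHardyLittlewood.Cruxes.MomentsBeyondDiagonal.PairsBeyondFamilySize

open Summit.Parity.GeneralizedHardyLittlewood.Theses.PrimeLevelFamEdge

/-! ## §1. The pair sums and the algebraic split of `Q^h(P, Q)` -/

section PairSums

variable {q : ℕ} [NeZero q]

/-- The `m`-th summand `λ_f(m) · x_m` of KMV's mollifier (9), `x_m = KMV2000.mollifierCoeff P M m`. -/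
def mollTerm (P : ℝ[X]) (M : ℝ) (f : CuspForm (Gamma0 q) 2) (m : ℕ) : ℂ :=
  GL2Family.heckeLambda f m * (KMV2000.mollifierCoeff P M m : ℂ)

/-- The WEIGHTED PAIR SUM `Σ_{m₁,m₂ ≤ M} w(m₁,m₂) · λ_f(m₁)x_{m₁} · conj(λ_f(m₂)x_{m₂})` — the part of
`|M_P(f)|²` carried by the pairs selected (with multiplicity `w`) by a real pair weight `w`. -/
def pairSum (P : ℝ[X]) (M : ℝ) (w : ℕ → ℕ → ℝ) (f : CuspForm (Gamma0 q) 2) : ℂ :=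
  ∑ m₁ ∈ Icc 1 ⌊M⌋₊, ∑ m₂ ∈ Icc 1 ⌊M⌋₊,
    ((w m₁ m₂ : ℝ) : ℂ) * (mollTerm P M f m₁ * (starRingEnd ℂ) (mollTerm P M f m₂))

/-- The complementary pair weight `1 − w`. -/
def compl (w : ℕ → ℕ → ℝ) : ℕ → ℕ → ℝ := fun m₁ m₂ ↦ 1 - w m₁ m₂

omit [NeZero q] in
/-- `M_P(f) = Σ_{m ≤ M} λ_f(m) x_m` (tree: `KMV2000.mollifierP_eq_sum_mollifierCoeff`). -/
theorem mollifierP_eq_sum_mollTerm (P : ℝ[X]) (M : ℝ) (f : CuspForm (Gamma0 q) 2) :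
    KMV2000.mollifierP q P M f = ∑ m ∈ Icc 1 ⌊M⌋₊, mollTerm P M f m :=
  KMV2000.mollifierP_eq_sum_mollifierCoeff P M f

omit [NeZero q] in
/-- The pairs selected by `w` and by `1 − w` together exhaust the square:
`pairSum w + pairSum (1 − w) = Σ_{m₁,m₂} λx(m₁) conj(λx(m₂))`. -/
theorem pairSum_add_pairSum_compl (P : ℝ[X]) (M : ℝ) (w : ℕ → ℕ → ℝ) (f : CuspForm (Gamma0 q) 2) :
    pairSum P M w f + pairSum P M (compl w) f =
      ∑ m₁ ∈ Icc 1 ⌊M⌋₊, ∑ m₂ ∈ Icc 1 ⌊M⌋₊, mollTerm P M f m₁ * (starRingEnd ℂ) (mollTerm P M f m₂) := by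
  unfold pairSum compl
  rw [← Finset.sum_add_distrib]
  refine Finset.sum_congr rfl fun m₁ _ ↦ ?_
  rw [← Finset.sum_add_distrib]
  refine Finset.sum_congr rfl fun m₂ _ ↦ ?_
  push_cast
  ring

omit [NeZero q] in
/-- `M_P(f) · conj M_P(f) = Σ_{m₁,m₂} λx(m₁) conj(λx(m₂))`. -/
theorem mollifierP_mul_conj (P : ℝ[X]) (M : ℝ) (f : CuspForm (Gamma0 q) 2) :
    KMV2000.mollifierP q P M f * (starRingEnd ℂ) (KMV2000.mollifierP q P M f) =
      ∑ m₁ ∈ Icc 1 ⌊M⌋₊, ∑ m₂ ∈ Icc 1 ⌊M⌋₊, mollTerm P M f m₁ * (starRingEnd ℂ) (mollTerm P M f m₂) := by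
  rw [mollifierP_eq_sum_mollTerm, map_sum, Finset.sum_mul_sum]

omit [NeZero q] in
/-- `|M_P(f)|² = pairSum w + pairSum (1 − w)` (as complex numbers). -/
theorem normSq_mollifierP_eq_pairSplit (P : ℝ[X]) (M : ℝ) (w : ℕ → ℕ → ℝ) (f : CuspForm (Gamma0 q) 2) :
    ((‖KMV2000.mollifierP q P M f‖ ^ 2 : ℝ) : ℂ) = pairSum P M w f + pairSum P M (compl w) f := by
  rw [pairSum_add_pairSum_compl, ← mollifierP_mul_conj, Complex.mul_conj, Complex.normSq_eq_norm_sq]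

/-- **The algebraic split of the mollified second moment (proved).** For every real pair weight `w`,
`Q^h(P,Q)(M) = Σ^h |Q̃Λ(f)|²·pairSum w + Σ^h |Q̃Λ(f)|²·pairSum (1 − w)`
(Petersson-side linearity of `Σ^h` over the finite family `S₂(q)^*`, `finite_newforms0_holds`). -/
theorem QhPQ_eq_pairSplit (P Q : ℝ[X]) (M : ℝ) (w : ℕ → ℕ → ℝ) :
    KMV2000.QhPQ q P Q M =
      GL2Family.harmonicSum q 2 (fun f ↦ ((‖KMV2000.Qtilde q Q f‖ ^ 2 : ℝ) : ℂ) * pairSum P M w f) +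
        GL2Family.harmonicSum q 2
          (fun f ↦ ((‖KMV2000.Qtilde q Q f‖ ^ 2 : ℝ) : ℂ) * pairSum P M (compl w) f) := by
  rw [← GL2Family.harmonicSum_add q 2 (finite_newforms0_holds q 2)]
  unfold KMV2000.QhPQ
  congr 1
  funext f
  rw [← mul_add, ← normSq_mollifierP_eq_pairSplit, norm_mul, mul_pow, Complex.ofReal_mul]

end PairSums

/-! ## §2. Cut families, the pieces, and the three sub-statements -/

/-- A CUT FAMILY: a real pair weight depending on the level `q` and the length exponent `Δ'`. -/
abbrev CutFamily : Type := ℕ → ℝ → ℕ → ℕ → ℝ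

/-- The complementary cut family `1 − ω`. -/
def complCut (ω : CutFamily) : CutFamily := fun q Δ' ↦ compl (ω q Δ')

/-- **The SHARP HYPERBOLIC CUT at exponent `ζ`:** select the mollifier pairs with `m₁ m₂ ≤ q̂^{ζ(Δ')}`. -/
def hyperbolicCut (ζ : ℝ → ℝ) : CutFamily :=
  fun q Δ' m₁ m₂ ↦ if ((m₁ * m₂ : ℕ) : ℝ) ≤ KMV2000.qhat q ^ (ζ Δ') then 1 else 0

/-- A SMOOTHED HYPERBOLIC CUT: weight `w(log(m₁m₂) / (ζ(Δ') log q̂))` for any real profile `w` (e.g. smooth,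
`= 1` on `(−∞, 1 − ε]`, `= 0` on `[1, ∞)`): the same split with no sharp boundary in the Mellin analysis.
The glue below holds for it verbatim (`MomentsBeyondDiagonal_of_smoothSplit`). -/
def smoothHyperbolicCut (w : ℝ → ℝ) (ζ : ℝ → ℝ) : CutFamily :=
  fun q Δ' m₁ m₂ ↦ w (Real.log ((m₁ * m₂ : ℕ) : ℝ) / (ζ Δ' * Real.log (KMV2000.qhat q)))

/-- The threshold exponent of record `ζ(Δ') = 3 − Δ'`: for `Δ' ∈ (1, 2)` one has `1 < ζ < 2`, so BELOW is
inside KMV Lemma 3.3's hypothesis `m₁m₂ ≤ q^{(3−Δ')/2} = q^{1−δ}`, `δ = (Δ'−1)/2`, with pair count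
`≍ q̂^{ζ} log q̂ = o(q̂²)`, and ABOVE (pairs with `q̂^{3−Δ'} < m₁m₂ ≤ q̂^{2Δ'}`) is non-empty. -/
def zetaStar : ℝ → ℝ := fun Δ' ↦ 3 - Δ'

/-- The harmonic second-moment PIECE carried by the cut `ω` at level `q`, profiles `P, Q`, length exponent `Δ'`:
`Σ^h_f |Q̃Λ(f)(½)|² · pairSum_{ω(q,Δ')}(f)` at `M = q̂^{Δ'}`. -/
def piece (ω : CutFamily) (q : ℕ) [NeZero q] (P Q : ℝ[X]) (Δ' : ℝ) : ℂ :=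
  GL2Family.harmonicSum q 2
    (fun f ↦ ((‖KMV2000.Qtilde q Q f‖ ^ 2 : ℝ) : ℂ) * pairSum P (KMV2000.qhat q ^ Δ') (ω q Δ') f)

/-- `Q^h(P,Q)(q̂^{Δ'}) = piece ω + piece (1 − ω)` (the split `QhPQ_eq_pairSplit` at `M = q̂^{Δ'}`). -/
theorem QhPQ_eq_piece_add_piece (ω : CutFamily) (q : ℕ) [NeZero q] (P Q : ℝ[X]) (Δ' : ℝ) :
    KMV2000.QhPQ q P Q (KMV2000.qhat q ^ Δ') = piece ω q P Q Δ' + piece (complCut ω) q P Q Δ' :=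
  QhPQ_eq_pairSplit P Q _ (ω q Δ')

/-- **PIECE ASYMPTOTICS on the window `(1, Δ]`** with main-term functional `t` (same normalisation
`2ζ(2)² q̂/(Δ'² log² q̂)` and the same error budget `C q̂ (log q̂)⁻³` as the second display of
`KMV2000.MomentAsymptotics`; same genericity side condition `M ∉ ℕ`). -/
def PieceAsymptotics (ω : CutFamily) (Δ : ℝ) (t : ℝ → ℝ[X] → ℝ[X] → ℝ) : Prop :=
  ∀ P Q : ℝ[X], KMV2000.Admissible P → KMV2000.IsEvenOrOdd Q → ∀ Δ' : ℝ, 1 < Δ' → Δ' ≤ Δ →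
    ∃ C : ℝ, ∃ q₀ : ℕ, ∀ (q : ℕ) [NeZero q], q.Prime → q₀ ≤ q →
      (∀ n : ℕ, (n : ℝ) ≠ KMV2000.qhat q ^ Δ') →
        ‖piece ω q P Q Δ' -
            ((2 * riemannZeta 2 ^ 2 *
                ((KMV2000.qhat q / (Δ' ^ 2 * Real.log (KMV2000.qhat q) ^ 2) : ℝ) : ℂ)) *
              ((t Δ' P Q : ℝ) : ℂ))‖ ≤
          C * KMV2000.qhat q * (Real.log (KMV2000.qhat q))⁻¹ ^ 3

/-- FIRST-moment asymptotics on the window `(1, Δ]` with main-term functional `lin + T₁` (verbatim the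
shape `FirstMomentBeyond` of the registered birth skeleton). -/
def FirstMomentBeyond (Δ : ℝ) (T₁ : ℝ → ℝ[X] → ℝ[X] → ℝ) : Prop :=
  ∀ P Q : ℝ[X], KMV2000.Admissible P → KMV2000.IsEvenOrOdd Q → ∀ Δ' : ℝ, 1 < Δ' → Δ' ≤ Δ →
    ∃ C : ℝ, ∃ q₀ : ℕ, ∀ (q : ℕ) [NeZero q], q.Prime → q₀ ≤ q →
      (∀ n : ℕ, (n : ℝ) ≠ KMV2000.qhat q ^ Δ') →
        ‖KMV2000.LhPQ q P Q (KMV2000.qhat q ^ Δ') -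
            ((riemannZeta 2 * ((Real.sqrt (KMV2000.qhat q) / (Δ' * Real.log (KMV2000.qhat q)) : ℝ) : ℂ)) *
              ((KMV2000.linForm Δ' P Q + T₁ Δ' P Q : ℝ) : ℂ))‖ ≤
          C * Real.sqrt (KMV2000.qhat q) * (Real.log (KMV2000.qhat q))⁻¹ ^ 2

/-- **Sub₁ (M; printed technology — Petersson + Weil reach `Δ < 2` for the first moment; birth stub
`stub_firstMomentBeyond`):** the first display on some window beyond the diagonal. -/
def SubFirst : Prop :=
  ∃ Δ : ℝ, 1 < Δ ∧ ∃ T₁ : ℝ → ℝ[X] → ℝ[X] → ℝ, FirstMomentBeyond Δ T₁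

/-- **Sub(ω): the piece of the second moment selected by the cut family `ω` has an asymptotic of the
printed shape, with SOME main-term functional `t`, on some window beyond the diagonal.** -/
def SubPairs (ω : CutFamily) : Prop :=
  ∃ Δ : ℝ, 1 < Δ ∧ ∃ t : ℝ → ℝ[X] → ℝ[X] → ℝ, PieceAsymptotics ω Δ t

/-- **Sub₂ = BELOW (M/L; print-adjacent):** the pairs with `m₁m₂ ≤ q̂^{3−Δ'}` — KMV Lemma 3.3 pair by
pair for the Kloosterman terms (its hypothesis `m₁m₂ ≪ q^{1−δ}` holds with `δ = (Δ'−1)/2`), plus the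
residue evaluation of the hyperbolically-cut diagonal `m₁n₁ = m₂n₂` (one extra Mellin variable for the
cut; not in print as a display). -/
def SubPairsBelow : Prop := SubPairs (hyperbolicCut zetaStar)

/-- **Sub₃ = ABOVE (XL; the localized heart):** the pairs with `m₁m₂ > q̂^{3−Δ'}` — the mollifier pairs
whose product exceeds (up to the margin `q̂^{Δ'−1}`) the family size `q̂²`; Lemma 3.3's hypothesis
fails for every one of them and Weil's bound (12) loses by a power; barrier-notes BN-7a's object
(phase cancellation beyond Parseval at ONE prime modulus) restricted to the hyperbolic corner. -/
def SubPairsAbove : Prop := SubPairs (complCut (hyperbolicCut zetaStar))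

/-! ## §3. The glue (kernel-checked) -/

/-- The crux under a LOCAL NAME (typer ls-idea-typ-1, D-0145 conversion): the generic glue theorems below conclude
`KA` (definitionally `MomentsBeyondDiagonal`), so that the ONLY theorem of this file concluding the route crux BY
NAME is the registered-shape composition `MomentsBeyondDiagonal_of` of §5 — the harness skeleton checker takes the
first crux-concluding theorem as the skeleton and requires its hypotheses to be registered stubs. -/
def KA : Prop := MomentsBeyondDiagonal

/-- `8 ≤ √q` for `q ≥ 64`, hence `1 ≤ q̂`. -/
private theorem one_le_qhat {q : ℕ} (hq : 64 ≤ q) : 1 ≤ KMV2000.qhat q := by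
  have hq64 : (64 : ℝ) ≤ q := by exact_mod_cast hq
  have hsq : (8 : ℝ) ≤ Real.sqrt q := by
    rw [show (8 : ℝ) = Real.sqrt 64 by
      rw [show (64 : ℝ) = 8 ^ 2 by norm_num, Real.sqrt_sq (by norm_num)]]
    exact Real.sqrt_le_sqrt hq64
  have hπ : 0 < 2 * Real.pi := by positivity
  unfold KMV2000.qhat
  rw [le_div_iff₀ hπ]
  linarith [Real.pi_lt_four]

/-- **GLUE (proved, every cut family `ω`): `SubFirst → SubPairs ω → SubPairs (1 − ω) → K_A`.**
Intersect the three windows; `T₁` from the first piece; `T₂ := t_ω + t_{1−ω} − secondMomentForm`; the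
second display is the sum of the two piece estimates (`QhPQ_eq_piece_add_piece` + triangle inequality). -/
theorem MomentsBeyondDiagonal_of_pairSplit (ω : CutFamily) :
    SubFirst → SubPairs ω → SubPairs (complCut ω) → KA := by
  rintro ⟨Δ₁, h₁, T₁, H₁⟩ ⟨Δ₂, h₂, tb, H₂⟩ ⟨Δ₃, h₃, ta, H₃⟩
  show MomentsBeyondDiagonal
  refine ⟨min Δ₁ (min Δ₂ Δ₃), lt_min h₁ (lt_min h₂ h₃), T₁,
    fun Δ' P Q ↦ tb Δ' P Q + ta Δ' P Q - KMV2000.secondMomentForm Δ' P Q, ?_⟩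
  intro P Q hP hQ Δ hlo hhi
  obtain ⟨C₁, q₁, HH₁⟩ := H₁ P Q hP hQ Δ hlo (hhi.trans (min_le_left _ _))
  obtain ⟨C₂, q₂, HH₂⟩ := H₂ P Q hP hQ Δ hlo (hhi.trans ((min_le_right _ _).trans (min_le_left _ _)))
  obtain ⟨C₃, q₃, HH₃⟩ := H₃ P Q hP hQ Δ hlo (hhi.trans ((min_le_right _ _).trans (min_le_right _ _)))
  refine ⟨max C₁ (C₂ + C₃), max (max q₁ (max q₂ q₃)) 64, fun q _ hq hq₀ hM ↦ ⟨?_, ?_⟩⟩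
  · have h := HH₁ q hq (le_trans (le_max_left _ _) (le_trans (le_max_left _ _) hq₀)) hM
    exact h.trans (mul_le_mul_of_nonneg_right
      (mul_le_mul_of_nonneg_right (le_max_left _ _) (Real.sqrt_nonneg _)) (sq_nonneg _))
  · have hb := HH₂ q hq
      (le_trans (le_max_left _ _) (le_trans (le_max_right _ _) (le_trans (le_max_left _ _) hq₀))) hM
    have ha := HH₃ q hq
      (le_trans (le_max_right _ _) (le_trans (le_max_right _ _) (le_trans (le_max_left _ _) hq₀))) hM
    have hq1 : 1 ≤ KMV2000.qhat q := one_le_qhat (le_trans (le_max_right _ _) hq₀)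
    have hq' : 0 ≤ KMV2000.qhat q := zero_le_one.trans hq1
    have hlog : 0 ≤ (Real.log (KMV2000.qhat q))⁻¹ := inv_nonneg.mpr (Real.log_nonneg hq1)
    have hX : 0 ≤ KMV2000.qhat q * (Real.log (KMV2000.qhat q))⁻¹ ^ 3 := mul_nonneg hq' (pow_nonneg hlog 3)
    rw [QhPQ_eq_piece_add_piece ω]
    set N₂ : ℂ := (2 * riemannZeta 2 ^ 2 *
        ((KMV2000.qhat q / (Δ ^ 2 * Real.log (KMV2000.qhat q) ^ 2) : ℝ) : ℂ)) with hN₂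
    have e : piece ω q P Q Δ + piece (complCut ω) q P Q Δ -
          N₂ * ((KMV2000.secondMomentForm Δ P Q +
              (tb Δ P Q + ta Δ P Q - KMV2000.secondMomentForm Δ P Q) : ℝ) : ℂ) =
        (piece ω q P Q Δ - N₂ * ((tb Δ P Q : ℝ) : ℂ)) +
          (piece (complCut ω) q P Q Δ - N₂ * ((ta Δ P Q : ℝ) : ℂ)) := by
      push_cast
      ring
    have key : ‖piece ω q P Q Δ + piece (complCut ω) q P Q Δ -
          N₂ * ((KMV2000.secondMomentForm Δ P Q +
              (tb Δ P Q + ta Δ P Q - KMV2000.secondMomentForm Δ P Q) : ℝ) : ℂ)‖ ≤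
        max C₁ (C₂ + C₃) * KMV2000.qhat q * (Real.log (KMV2000.qhat q))⁻¹ ^ 3 := by
     rw [e]
     calc ‖(piece ω q P Q Δ - N₂ * ((tb Δ P Q : ℝ) : ℂ)) +
            (piece (complCut ω) q P Q Δ - N₂ * ((ta Δ P Q : ℝ) : ℂ))‖
        ≤ ‖piece ω q P Q Δ - N₂ * ((tb Δ P Q : ℝ) : ℂ)‖ +
            ‖piece (complCut ω) q P Q Δ - N₂ * ((ta Δ P Q : ℝ) : ℂ)‖ := norm_add_le _ _
      _ ≤ C₂ * KMV2000.qhat q * (Real.log (KMV2000.qhat q))⁻¹ ^ 3 +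
            C₃ * KMV2000.qhat q * (Real.log (KMV2000.qhat q))⁻¹ ^ 3 := add_le_add hb ha
      _ = (C₂ + C₃) * (KMV2000.qhat q * (Real.log (KMV2000.qhat q))⁻¹ ^ 3) := by ring
      _ ≤ max C₁ (C₂ + C₃) * (KMV2000.qhat q * (Real.log (KMV2000.qhat q))⁻¹ ^ 3) :=
          mul_le_mul_of_nonneg_right (le_max_right _ _) hX
      _ = max C₁ (C₂ + C₃) * KMV2000.qhat q * (Real.log (KMV2000.qhat q))⁻¹ ^ 3 := by ring
    exact key

/-- **The split of record (proved): `SubFirst → SubPairsBelow → SubPairsAbove → K_A`** at the hyperbolic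
cut `m₁m₂ ≤ q̂^{3−Δ'}`. -/
theorem MomentsBeyondDiagonal_of_hyperbolicSplit :
    SubFirst → SubPairsBelow → SubPairsAbove → KA :=
  MomentsBeyondDiagonal_of_pairSplit (hyperbolicCut zetaStar)

/-- The same glue at a SMOOTHED hyperbolic cut (any profile `w`, any exponent `ζ`). -/
theorem MomentsBeyondDiagonal_of_smoothSplit (w : ℝ → ℝ) (ζ : ℝ → ℝ) :
    SubFirst → SubPairs (smoothHyperbolicCut w ζ) → SubPairs (complCut (smoothHyperbolicCut w ζ)) →
      KA :=
  MomentsBeyondDiagonal_of_pairSplit (smoothHyperbolicCut w ζ)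

/-! ## §4. Sanity: the cut is a genuine cut (neither piece is the whole square identically) -/

/-- BELOW selects the pair `(1,1)` whenever `q̂ ≥ 1` and `ζ ≥ 0`-valued thresholds: at `(m₁,m₂) = (1,1)` the
hyperbolic weight is `1` as soon as `1 ≤ q̂^{ζ(Δ')}`. -/
theorem hyperbolicCut_one_one (ζ : ℝ → ℝ) (q : ℕ) (Δ' : ℝ) (h : (1 : ℝ) ≤ KMV2000.qhat q ^ ζ Δ') :
    hyperbolicCut ζ q Δ' 1 1 = 1 := by
  simp [hyperbolicCut, h]

/-- ABOVE selects every pair whose product exceeds the threshold (weight `1 − 0 = 1`). -/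
theorem complCut_hyperbolicCut_of_lt (ζ : ℝ → ℝ) (q : ℕ) (Δ' : ℝ) (m₁ m₂ : ℕ)
    (h : KMV2000.qhat q ^ ζ Δ' < ((m₁ * m₂ : ℕ) : ℝ)) :
    complCut (hyperbolicCut ζ) q Δ' m₁ m₂ = 1 := by
  have h' : KMV2000.qhat q ^ ζ Δ' < (m₁ : ℝ) * m₂ := by exact_mod_cast h
  simp [complCut, compl, hyperbolicCut, not_le.mpr h']

/-! ## §4b. Witnesses for the SCHEMA `SubPairs ·` (costume test E3): the ZERO cut is provable outright,
the FULL cut is the second display of `K_A` — the instance of record `ζ⋆` lies strictly between (§4). -/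

/-- `piece` at the ZERO cut vanishes identically. -/
theorem piece_zeroCut (q : ℕ) [NeZero q] (P Q : ℝ[X]) (Δ' : ℝ) :
    piece (fun _ _ _ _ ↦ (0 : ℝ)) q P Q Δ' = 0 := by
  simp [piece, pairSum, GL2Family.harmonicSum]

/-- `SubPairs 0` is PROVABLE (`t = 0`, `C = 0`): the schema `SubPairs ω` has trivially-true members, so
`SubPairs ω → K_A` is NOT uniform in `ω` — the glue genuinely consumes the complementary piece. -/
theorem subPairs_zeroCut : SubPairs (fun _ _ _ _ ↦ (0 : ℝ)) := by
  refine ⟨2, by norm_num, fun _ _ _ ↦ 0, ?_⟩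
  intro P Q _ _ Δ' _ _
  refine ⟨0, 0, fun q _ _ _ _ ↦ ?_⟩
  simp [piece_zeroCut]

/-- `K_A ⟹ SubFirst` (projection to the first display): `SubFirst` is a CONSEQUENCE of `K_A` used toward
`K_A`; the converse probe fails (bc/implication_probes.lean P-F), so it is not `K_A` re-lettered. -/
theorem subFirst_of_momentsBeyondDiagonal (h : MomentsBeyondDiagonal) : SubFirst := by
  obtain ⟨Δ, hΔ, T₁, T₂, hMA⟩ := h
  refine ⟨Δ, hΔ, T₁, ?_⟩
  intro P Q hP hQ Δ' h1 h2
  obtain ⟨C, q₀, hC⟩ := hMA P Q hP hQ Δ' h1 h2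
  exact ⟨C, q₀, fun q _ hq hq₀ hgen ↦ (hC q hq hq₀ hgen).1⟩

/-- The complement of the FULL cut is the ZERO cut. -/
theorem complCut_oneCut : complCut (fun _ _ _ _ ↦ (1 : ℝ)) = fun _ _ _ _ ↦ (0 : ℝ) := by
  funext q Δ' m₁ m₂
  simp [complCut, compl]

/-- At the FULL cut the piece is `Q^h(P,Q)(q̂^{Δ'})` itself. -/
theorem piece_oneCut (q : ℕ) [NeZero q] (P Q : ℝ[X]) (Δ' : ℝ) :
    piece (fun _ _ _ _ ↦ (1 : ℝ)) q P Q Δ' = KMV2000.QhPQ q P Q (KMV2000.qhat q ^ Δ') := by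
  have h := QhPQ_eq_piece_add_piece (fun _ _ _ _ ↦ (1 : ℝ)) q P Q Δ'
  rw [complCut_oneCut, piece_zeroCut, add_zero] at h
  exact h.symm

/-- `K_A` ⟹ the FULL cut's piece asymptotics, with `t = secondMomentForm + T₂` (the full cut IS the
second display). Together with `subPairs_zeroCut`: the family `ω ↦ SubPairs ω` runs from trivially
true (`ω = 0`) to the second half of `K_A` (`ω = 1`). -/
theorem subPairs_oneCut_of_momentsBeyondDiagonal (h : MomentsBeyondDiagonal) :
    SubPairs (fun _ _ _ _ ↦ (1 : ℝ)) := by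
  obtain ⟨Δ, hΔ, T₁, T₂, hMA⟩ := h
  refine ⟨Δ, hΔ, fun Δ' P Q ↦ KMV2000.secondMomentForm Δ' P Q + T₂ Δ' P Q, ?_⟩
  intro P Q hP hQ Δ' h1 h2
  obtain ⟨C, q₀, hC⟩ := hMA P Q hP hQ Δ' h1 h2
  refine ⟨C, q₀, fun q _ hq hq₀ hgen ↦ ?_⟩
  rw [piece_oneCut]
  exact (hC q hq hq₀ hgen).2

/-- Conversely `SubFirst ∧ SubPairs 1 ⟹ K_A` (glue at the full cut; the complementary piece is the zero
cut, provable): the full cut is exactly as strong as `K_A`'s second display given the first. -/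
theorem momentsBeyondDiagonal_of_subFirst_subPairs_oneCut (h₁ : SubFirst)
    (h₂ : SubPairs (fun _ _ _ _ ↦ (1 : ℝ))) : KA := by
  refine MomentsBeyondDiagonal_of_pairSplit (fun _ _ _ _ ↦ (1 : ℝ)) h₁ h₂ ?_
  rw [complCut_oneCut]
  exact subPairs_zeroCut

/-! ## §5. REGISTERED-SHAPE SKELETON (for ls-idea-typ-1: `Cruxes/MomentsBeyondDiagonal/Lines/pairs-beyond-family-size.lean`)
Three named stubs (the only `sorry`s of this file) and the composition concluding the ROUTE crux BY NAME. -/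

/-- stub (M; printed technology — Petersson + Weil + the approximate functional equation reach the first moment
up to length `q̂^{2}`; `T₁ = 0` on `(1,2)` at `Q = 1` is the tree's `KMV2000.firstDisplay_of_bettin` under
`bettin2017_theorem11_primeLevel`; identical in statement to the birth skeleton's `stub_firstMomentBeyond`). -/
theorem stub_firstMomentBeyond :
    ∃ Δ : ℝ, 1 < Δ ∧ ∃ T₁ : ℝ → ℝ[X] → ℝ[X] → ℝ, FirstMomentBeyond Δ T₁ := by
  sorry

/-- stub (M/L; print-adjacent — BELOW): the harmonic second-moment piece carried by the mollifier pairs with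
`m₁m₂ ≤ q̂^{3−Δ'}` has an asymptotic of the printed shape on some window beyond the diagonal: KMV Lemma 3.3
pair by pair (hypothesis `m₁m₂ ≪ q^{1−δ}`, `δ = (Δ'−1)/2`; pair count `≍ q̂^{3−Δ'} log q̂ = o(q̂²)`) for the
Kloosterman terms + the residue evaluation of the hyperbolically-cut diagonal for the main term `t_below`. -/
theorem stub_pairsBelow :
    ∃ Δ : ℝ, 1 < Δ ∧ ∃ t : ℝ → ℝ[X] → ℝ[X] → ℝ, PieceAsymptotics (hyperbolicCut zetaStar) Δ t := by
  sorry

/-- stub (XL; the localized heart — ABOVE): the piece carried by the mollifier pairs with `m₁m₂ > q̂^{3−Δ'}`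
(pairs beyond the family size, up to the margin `q̂^{Δ'−1}`) has an asymptotic of the printed shape with SOME
level-independent main-term functional `t_above` on some window beyond the diagonal. Lemma 3.3's hypothesis
fails for every such pair; Weil's bound loses by `q̂^{2Δ'−1}`; barrier-notes BN-7a (phase cancellation beyond
Parseval at one prime modulus) is the wall of record for this piece. -/
theorem stub_pairsAbove :
    ∃ Δ : ℝ, 1 < Δ ∧ ∃ t : ℝ → ℝ[X] → ℝ[X] → ℝ,
      PieceAsymptotics (complCut (hyperbolicCut zetaStar)) Δ t := by
  sorry

/-- **Composition in REGISTERED shape: the ROUTE crux `MomentsBeyondDiagonal` from the three named stubs**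
(kernel-checked glue `MomentsBeyondDiagonal_of_hyperbolicSplit`; the only sorries of this file live inside `stub_*`). -/
theorem MomentsBeyondDiagonal_of : MomentsBeyondDiagonal :=
  MomentsBeyondDiagonal_of_hyperbolicSplit stub_firstMomentBeyond stub_pairsBelow stub_pairsAbove

end Summit.Parity.GeneralizedHardyLittlewood.Cruxes.MomentsBeyondDiagonal.PairsBeyondFamilySize

end
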